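import Literature.Probability.RandomPlanarGeometry.CritPercSLESimplePathProofs
import HarnessLib

/-!
# Loewner chains driven by `√κ Bₜ + c t`: no positive real point is swallowed for `κ ≤ 4`

Topic `Probability/RandomPlanarGeometry`. One named fact and its first consequences, isolated from
the proof of [LSW] Lemma 8.3 (2) (the positive real points are never swallowed by SLE(κ, ρ),
`κ ≤ 4`; `Literature/Probability/RandomPlanarGeometry/SLEKappaRho.lean`,
`Literature.Probability.RandomPlanarGeometry.SLEKappaRho.swallowingTime_ofReal`):

> [LSW] p. 36, proof of Lemma 8.3: "Setting `x̃ₜ = xₜ - Wₜ`, we get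
> `dx̃ₜ ≥ -2|ρ| dt - √κ dBₜ + (2/x̃ₜ) dt` on the set of times `t` such that `x̃ₜ < 1/2`. If `ρ = 0`,
> by comparing with the Bessel process we see that a.s. `x̃ₜ` never hits `0` and so `τ₁ = ∞`. For
> `ρ ≠ 0`, note that for any finite fixed `t₀ > 0` and any `c ∈ ℝ` the law of the process
> `(Bₜ + c t, t ≤ t₀)` is equicontinuous with the law of `(Bₜ, t ≤ t₀)`. (In fact, after
> conditioning on the position of the process at time `t₀`, their distribution is identical.)
> Therefore, also in this case `x̃ₜ` never hits `0` and `τ₁ = ∞`."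

The stochastic content of the last two sentences is the following statement about the chordal
Loewner chain driven by a Brownian motion WITH DRIFT, which this file vendors as the named fact
`Literature.Probability.RandomPlanarGeometry.sle_drift_swallowingTime_ofReal_eq_top`: for
`0 < κ ≤ 4` and every real `c`, almost surely no real `x > 0` is swallowed by the Loewner flow
driven by `t ↦ √κ Bₜ + c t` — the drifted form of Lawler (2005), Prop. 6.8 (i) / Prop. 1.21
("if `a ≥ 1/2`, then w.p.1 `T_x = ∞` for all `x > 0`", the case `c = 0`, which is the tree's
theorem `sle_swallowingTime_ofReal_eq_top_holds`, `CritPercSLESimplePathProofs`), obtained in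
[LSW] from the mutual absolute continuity of the laws of `(Bₜ + ct)_{t ≤ t₀}` and `(Bₜ)_{t ≤ t₀}`
(Cameron–Martin / Girsanov), and provable directly by Lawler's optional-stopping argument for the
flow `dX = (2/X - c) dt - √κ dB`, whose scale density `u^{-4/κ} e^{2cu/κ}` is not integrable at
`0+` exactly when `κ ≤ 4`.

PROVED here: the case `c = 0` is the tree's theorem (`sle_drift_swallowingTime_ofReal_eq_top_zero`),
and the **Markov shift** of the fact (`ae_forall_swallowingTime_shift_add_mul_eq_top`): for every
`q ≥ 0`, almost surely no `x > 0` is swallowed by the flow driven by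
`t ↦ (√κ B_{q+t} - √κ B_q) + c t` (law transfer `Loewner.ae_forall_swallowingTime_eq_top_of_identDistrib`
along `identDistrib_sleDriving_shift`), which is the form in which the comparison argument of
[LSW] Lemma 8.3 (2) consumes it (restarting the comparison flow at rational times).

## References

* G. F. Lawler, O. Schramm, W. Werner, *Conformal restriction: the chordal case*, J. Amer. Math.
  Soc. 16 (2003), §8.3, proof of Lemma 8.3 (arXiv p. 36).
* G. F. Lawler, *Conformally Invariant Processes in the Plane*, AMS (2005), §1.10 Prop. 1.21,
  §6.2 Prop. 6.8.
* D. Revuz, M. Yor, *Continuous Martingales and Brownian Motion* (1999), Ch. VIII §1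
  (Girsanov / Cameron–Martin).
-/

noncomputable section

open MeasureTheory ProbabilityTheory Filter Set
open scoped NNReal

namespace Literature.Probability.RandomPlanarGeometry

/-- NAMED FACT — **no positive real point is swallowed by the Loewner chain driven by
`√κ Bₜ + c t`, `κ ≤ 4`** ([LSW] proof of Lemma 8.3, p. 36: "for any finite fixed `t₀ > 0` and
any `c ∈ ℝ` the law of the process `(Bₜ + c t, t ≤ t₀)` is equicontinuous [mutually absolutely
continuous] with the law of `(Bₜ, t ≤ t₀)` … Therefore, also in this case `x̃ₜ` never hits `0`";
the case `c = 0` is Lawler (2005), Prop. 6.8 (i): "If `κ ≤ 4`, then w.p.1 `T_x = ∞` for all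
`x > 0`", the tree's `sle_swallowingTime_ofReal_eq_top`). In the tree's terms: for `0 < κ ≤ 4`
and every real `c`, almost surely (pre-Wiener measure on the canonical space, `B = brownian`),
every real `x > 0` has swallowing time `⊤` (`Loewner.swallowingTime`, the lifetime of the real
Loewner flow `ġ = 2/(g - W)`) under the driving function `t ↦ √κ Bₜ + c t`
(`sleDriving κ ω t + c * t`). Named fact (closed `Prop`; range `0 < κ ≤ 4` of the printed
`κ ≤ 4`). [cite: LawlerSchrammWerner2003Restriction, proof of Lemma 8.3 (p. 36)] -/
def sle_drift_swallowingTime_ofReal_eq_top : Prop :=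
  ∀ ⦃κ : ℝ≥0⦄, 0 < κ → κ ≤ 4 → ∀ c : ℝ,
    ∀ᵐ ω ∂Process.preWienerMeasure, ∀ x : ℝ, 0 < x →
      Loewner.swallowingTime (fun t ↦ sleDriving κ ω t + c * (t : ℝ)) x = ⊤

/-- **The case `c = 0` is Lawler's Prop. 6.8 (i)**, a theorem of the tree
(`sle_swallowingTime_ofReal_eq_top_holds`, `CritPercSLESimplePathProofs`). [cite: Lawler2005, Prop. 6.8] -/
theorem sle_drift_swallowingTime_ofReal_eq_top_zero {κ : ℝ≥0} (hκ : κ ≤ 4) :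
    ∀ᵐ ω ∂Process.preWienerMeasure, ∀ x : ℝ, 0 < x →
      Loewner.swallowingTime (fun t ↦ sleDriving κ ω t + 0 * (t : ℝ)) x = ⊤ := by
  filter_upwards [sle_swallowingTime_ofReal_eq_top_holds hκ] with ω hω x hx
  have : (fun t : ℝ≥0 ↦ sleDriving κ ω t + 0 * (t : ℝ)) = sleDriving κ ω := by
    funext t; simp
  rw [this]
  exact hω x hx

/-- Adding the linear drift `c t` to a path: a measurable self-map of the path space (product
σ-algebra). [folklore] -/
theorem measurable_add_linear (c : ℝ) :
    Measurable fun (w : ℝ≥0 → ℝ) (t : ℝ≥0) ↦ w t + c * (t : ℝ) :=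
  measurable_pi_lambda _ fun t ↦ (measurable_pi_apply t).add_const _

/-- **Markov shift of the drifted driving function in law**: for `q ≥ 0`, the paths
`t ↦ √κ Bₜ + c t` and `t ↦ (√κ B_{q+t} - √κ B_q) + c t` have the same law on the path space
(`identDistrib_sleDriving_shift` composed with `w ↦ w + c·`). [cite: RohdeSchramm2005, Prop. 2.1] -/
theorem identDistrib_sleDriving_shift_add_linear (κ : ℝ≥0) (c : ℝ) (q : ℝ≥0) :
    IdentDistrib (fun ω (t : ℝ≥0) ↦ sleDriving κ ω t + c * (t : ℝ))
      (fun ω (t : ℝ≥0) ↦ sleDriving κ ω (q + t) - sleDriving κ ω q + c * (t : ℝ))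
      Process.preWienerMeasure Process.preWienerMeasure :=
  (identDistrib_sleDriving_shift κ q).comp (measurable_add_linear c)

/-- **The Markov shift of the named fact.** If no positive real is swallowed by the chain of
`√κ B + c·` (`sle_drift_swallowingTime_ofReal_eq_top`), then for every `q ≥ 0`, almost surely no
real `x > 0` is swallowed by the chain driven by `t ↦ (√κ B_{q+t} - √κ B_q) + c t`: both driving
paths are continuous, vanish at `0` and have the same law (`identDistrib_sleDriving_shift_add_linear`),
and the non-swallowing event transfers along identities in law
(`Loewner.ae_forall_swallowingTime_eq_top_of_identDistrib`). This is how the comparison flows of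
[LSW] Lemma 8.3 (2) are restarted at rational times.
[cite: LawlerSchrammWerner2003Restriction, proof of Lemma 8.3 (p. 36)] -/
theorem ae_forall_swallowingTime_shift_add_mul_eq_top (h : sle_drift_swallowingTime_ofReal_eq_top)
    {κ : ℝ≥0} (hκ0 : 0 < κ) (hκ : κ ≤ 4) (c : ℝ) (q : ℝ≥0) :
    ∀ᵐ ω ∂Process.preWienerMeasure, ∀ x : ℝ, 0 < x →
      Loewner.swallowingTime (fun t ↦ sleDriving κ ω (q + t) - sleDriving κ ω q + c * (t : ℝ)) x = ⊤ := by
  refine Loewner.ae_forall_swallowingTime_eq_top_of_identDistrib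
    (W₁ := fun ω (t : ℝ≥0) ↦ sleDriving κ ω t + c * (t : ℝ))
    (W₂ := fun ω (t : ℝ≥0) ↦ sleDriving κ ω (q + t) - sleDriving κ ω q + c * (t : ℝ))
    (fun ω ↦ (continuous_sleDriving κ ω).add (continuous_const.mul NNReal.continuous_coe))
    (fun ω ↦ (continuous_sleDriving_shift κ ω q).add (continuous_const.mul NNReal.continuous_coe))
    (fun ω ↦ by simp) (fun ω ↦ by simp) (identDistrib_sleDriving_shift_add_linear κ c q) (h hκ0 hκ c)

end Literature.Probability.RandomPlanarGeometry

end
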